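import Summits.BirchSwinnertonDyer.BirchSwinnertonDyer.Theorems.UniversalToricDescentAdditiveLocalTerm
import Summits.BirchSwinnertonDyer.Rank1Residual.X2.LocalInertiaCohomologyAdditive
import HarnessLib

/-!
# Route UniversalToricDescent — `H¹(H ∩ I_v, E[p^∞]) = 0` at an ADDITIVE place `v ∤ p` (the place-by-place
# currency `discreteH1 (inertiaIn H v) (W.geomPrimaryTorsion p)` of the Greenberg–Vatsal local conditions)

Lead prover bsd-wall-utd-p1 g10 (`--supports stmt-BirchSwinnertonDyer-20399`; cross-route corollary of
`UniversalToricDescentAdditiveLocalTerm` for the consumers that work in the `inertiaIn` currency: X2's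
`LocalInertiaCohomologyAdditive` (FINITENESS of this group, Greenberg–Vatsal (2.4) with `d_v = 0`) and the
`ThetaPartnerAtTwo` line `bridge` (`stub_loc2`: `zpCorank_eq_zero_of_le_discreteH1_inertiaIn_of_additive`),
now sharpened from "finite" / "corank `0`" to ZERO:

* `subsingleton_discreteH1_inertiaIn_of_hasAdditiveReductionAt` — for `E/K`, a prime `p`, a finite place
  `v ∤ p` of ADDITIVE reduction and `H ≤ Γ_K` containing `I_v`: **`H¹(H ∩ I_v, E[p^∞]) = 0`**.

Proof: `H ∩ I_v` is the image of `absInertia K_v`, inflation along a surjection is injective on `H¹`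
(`map_one_injective_of_surjective`, as in X2's file), and `H¹(absInertia K_v, E[p^∞]) = 0`
(`subsingleton_continuousCohomology_one_absInertia_of_finite_invariants`: `E[p^∞]` is `p`-divisible with
finite layers and its `I_v`-invariants are finite at an additive `v ∤ p`, Serre–Tate / *ATAEC* IV.10.2(a)).
Any `p` (no parity hypothesis).

THEOREMS ONLY; no definition, no named fact, no `sorry`. BSD is not advanced by this file.
References: [GreenbergVatsal2000] §2 Prop. (2.4) (arXiv p. 22); [Greenberg1989] Prop. 2;
[SilvermanATAEC1994] Thm. IV.10.2(a); [SilvermanAEC2009] VII.6.1.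
-/

set_option autoImplicit false
-- `…BirchSwinnertonDyer.BirchSwinnertonDyer.Theorems…` is the problem's mandated namespace (D-0017).
set_option linter.dupNamespace false

noncomputable section

open scoped Classical

namespace Summit.BirchSwinnertonDyer.BirchSwinnertonDyer.Theorems.UniversalToricDescentAdditiveLocalTerm

open CategoryTheory Function NumberField IsDedekindDomain Field ValuativeRel
open Literature.NumberTheory.EllipticCurves Literature.NumberTheory.EllipticCurves.GreenbergSelmer
  Literature.NumberTheory.GaloisRepresentations
  Literature.NumberTheory.GaloisRepresentations.IsNonarchimedeanLocalField
  IsDedekindDomain.HeightOneSpectrum ContinuousCohomology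
  Summit.BirchSwinnertonDyer.Rank1Residual.X11b.LocBridge
  Summit.BirchSwinnertonDyer.Rank1Residual.Iwasawa


variable {K : Type} [Field K] [NumberField K] (W : WeierstrassCurve K) [W.IsElliptic] (p : ℕ)
  [hp : Fact p.Prime] (H : Subgroup (absoluteGaloisGroup K)) (v : HeightOneSpectrum (𝓞 K))

/-- **`H¹(H ∩ I_v, E[p^∞]) = 0` at an ADDITIVE place `v ∤ p`** (for `I_v ≤ H`; any prime `p`): inflation
along `absInertia K_v ↠ H ∩ I_v` is injective and `H¹(absInertia K_v, E[p^∞]) = 0` since `E[p^∞]^{I_v}` is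
finite. Sharpens X2's `finite_discreteH1_inertiaIn_of_hasAdditiveReductionAt` (finite) to zero — the case
`d_v = 0`, `P_v = 1` of Greenberg–Vatsal's Prop. (2.4) on the inertia side, exactly.
[cite: GreenbergVatsal2000, §2 Prop. (2.4) (arXiv p. 22)] [cite: SilvermanATAEC1994, Thm. IV.10.2(a)]
[cite: SilvermanAEC2009, Thm. VII.6.1] -/
theorem subsingleton_discreteH1_inertiaIn_of_hasAdditiveReductionAt
    (hpv : ((p : ℕ) : 𝓞 K) ∉ v.asIdeal) (hadd : W.HasAdditiveReductionAt v) (hIH : inertia v ≤ H) :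
    Subsingleton (discreteH1 (inertiaIn H v) (W.geomPrimaryTorsion p)) := by
  -- the local field, the module, the local representation
  let Fv := v.adicCompletion K
  haveI : CharZero Fv := charZero_of_injective_algebraMap (algebraMap K Fv).injective
  haveI : CompactSpace (absoluteGaloisGroup Fv) := absoluteGaloisGroup_compactSpace Fv
  let A : Type := W.geomPrimaryTorsion p
  let ρ : ContinuousRep (absoluteGaloisGroup Fv) ℤ A :=
    (primaryGaloisModule W p).restrict (absGaloisRestrict K Fv)
  have hρ : ∀ (σ : absoluteGaloisGroup Fv) (a : A), ρ σ a = absGaloisRestrict K Fv σ • a := fun _ _ ↦ rfl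
  -- the surjection `θ : absInertia K_v ↠ H ∩ I_v` (as in X2's file)
  let θ : absInertia Fv →ₜ* inertiaIn H v :=
    { toFun := fun σ ↦ ⟨⟨absGaloisRestrict K Fv σ, ⟨σ, rfl⟩⟩,
        (mem_inertiaIn_iff H v _).2
          ⟨hIH (Subgroup.mem_map_of_mem _ σ.2), Subgroup.mem_map_of_mem _ σ.2⟩⟩
      map_one' := Subtype.ext (Subtype.ext (by simp))
      map_mul' := fun x y ↦ Subtype.ext (Subtype.ext (by simp))
      continuous_toFun := by
        refine Continuous.subtype_mk (Continuous.subtype_mk ?_ _) _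
        exact (absGaloisRestrict K Fv).continuous_toFun.comp continuous_subtype_val }
  have hθ : Surjective θ := by
    intro x
    obtain ⟨σ, hσ, hσx⟩ := Subgroup.mem_map.1 ((mem_inertiaIn_iff H v x.1).1 x.2).2
    exact ⟨⟨σ, hσ⟩, Subtype.ext (Subtype.ext hσx)⟩
  have hinj := map_one_injective_of_surjective (discreteTopRep (inertiaIn H v) A) θ hθ
  have heq : TopRep.res (θ : absInertia Fv →* inertiaIn H v) (discreteTopRep (inertiaIn H v) A) =
      (ρ.restrict (Literature.NumberTheory.GaloisRepresentations.subgroupIncl (absInertia Fv))).toTopRep := rfl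
  -- the hypotheses of the vanishing theorem for `A = E[p^∞]`
  have hℓ : ringChar 𝓀[Fv] ≠ p := v.ringChar_residueField_adicCompletion_ne hpv
  have hA : ∀ a : A, ∃ k : ℕ, p ^ k • a = 0 := fun a ↦ by
    obtain ⟨k, hk⟩ := (AddCommGroup.mem_primaryComponent).1 a.2
    exact ⟨k, Subtype.ext (by rw [AddSubmonoidClass.coe_nsmul, ZeroMemClass.coe_zero]; exact hk)⟩
  have hdiv : ∀ a : A, ∃ b : A, p • b = a := fun a ↦ by
    obtain ⟨m, hm⟩ := (AddCommGroup.mem_primaryComponent).1 a.2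
    obtain ⟨B, hB⟩ := W.exists_nsmul_eq_geomPoints (W.zsmul_geomPoints_surjective_holds) hp.out.ne_zero
      (a : W.geomPoints)
    have hBmem : B ∈ W.geomPrimaryTorsion p := by
      refine (AddCommGroup.mem_primaryComponent).2 ⟨1 + m, ?_⟩
      rw [pow_add, pow_one, mul_comm, mul_nsmul', hB]
      exact hm
    exact ⟨⟨B, hBmem⟩, Subtype.ext (by rw [AddSubmonoidClass.coe_nsmul]; exact hB)⟩
  have hfin : ∀ k : ℕ, Set.Finite {a : A | p ^ k • a = 0} := fun k ↦ by
    haveI : Finite (W.geomTorsion ((p ^ k : ℕ) : ℤ)) :=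
      WeierstrassCurve.finite_torsionPoints_holds W (AlgebraicClosure K)
        (Int.natCast_ne_zero.mpr (pow_ne_zero k hp.out.ne_zero))
    let f : {a : A | p ^ k • a = 0} → W.geomTorsion ((p ^ k : ℕ) : ℤ) := fun a ↦
      ⟨((a : A) : W.geomPoints), (W.mem_geomTorsion_iff ((p ^ k : ℕ) : ℤ) _).2 (by
        rw [natCast_zsmul, ← AddSubmonoidClass.coe_nsmul, (a.2 : p ^ k • (a : A) = 0),
          ZeroMemClass.coe_zero])⟩
    have hf : Injective f := fun a b hab ↦
      Subtype.ext (Subtype.ext (congrArg (fun x : W.geomTorsion ((p ^ k : ℕ) : ℤ) ↦ (x : W.geomPoints)) hab))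
    haveI := Finite.of_injective f hf
    exact Set.toFinite _
  have hfix : Set.Finite {a : A | ∀ σ ∈ absInertia Fv, ρ σ a = a} := by
    obtain ⟨c, hc, hkill⟩ := W.exists_nsmul_eq_zero_of_absInertia_fixed_of_hasAdditiveReductionAt p hpv hadd
    haveI : Finite (W.geomTorsion (c : ℤ)) :=
      WeierstrassCurve.finite_torsionPoints_holds W (AlgebraicClosure K) (Int.natCast_ne_zero.mpr hc)
    let f : {a : A | ∀ σ ∈ absInertia Fv, ρ σ a = a} → W.geomTorsion (c : ℤ) := fun a ↦
      ⟨((a : A) : W.geomPoints), (W.mem_geomTorsion_iff (c : ℤ) _).2 (by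
        obtain ⟨k, hk⟩ := (AddCommGroup.mem_primaryComponent).1 (a : A).2
        rw [natCast_zsmul]
        exact hkill _ (fun σ hσ ↦ congrArg Subtype.val (a.2 σ hσ)) k hk)⟩
    have hf : Injective f := fun a b hab ↦
      Subtype.ext (Subtype.ext (congrArg (fun x : W.geomTorsion (c : ℤ) ↦ (x : W.geomPoints)) hab))
    haveI := Finite.of_injective f hf
    exact Set.toFinite _
  haveI hI : Subsingleton (continuousCohomology 1
      ((ρ.restrict (Literature.NumberTheory.GaloisRepresentations.subgroupIncl (absInertia Fv))).toTopRep)) :=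
    subsingleton_continuousCohomology_one_absInertia_of_finite_invariants Fv hℓ ρ hA hdiv hfin hfix
  haveI : Subsingleton (continuousCohomology 1
      (TopRep.res (θ : absInertia Fv →* inertiaIn H v) (discreteTopRep (inertiaIn H v) A))) := by
    rw [heq]; exact hI
  exact ⟨fun a b ↦ hinj (Subsingleton.elim _ _)⟩

end Summit.BirchSwinnertonDyer.BirchSwinnertonDyer.Theorems.UniversalToricDescentAdditiveLocalTerm

end
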